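import Mathlib
import HarnessLib
import Summits.Langlands.Langlands.Theses.BaseFieldAscent
import Summits.Langlands.Langlands.Theorems.IrreducibilityBySelfDualityReciprocityUpToIrreducibilityCorrespondsConj

/-!
# Birth skeleton (BC3) for crux stmt-Langlands-1093
`Summit.Langlands.Langlands.Theses.BaseFieldAscent.ReciprocityTRCM` — line `birth`

Route `route-Langlands-BaseFieldAscent` (`closes : ReciprocityTRCM → AscentConjugationSolvable →
AscentResidual → Langlands`). The crux is the summit body restricted to totally real and CM base fields:
`∀ F, IsTotallyReal F ∨ IsCMField F → ∃ 𝓡, ∀ n > 0, ∀ hcpt, GlobalLanglandsCorrespondenceGLn n F 𝓡 hcpt`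
(both directions, all `n`, all weights, local–global compatibility at every finite place).

This file concludes the crux BY NAME from three named stubs, cut along the two seams every known engine
respects — the DIRECTION seam ((A) construction of Galois representations / (B) automorphy of geometric
Galois representations) over the CM core, and the FIELD seam (CM ⇒ totally real):

* `stub_autToGalCM` — direction (A) over CM fields, all `n`, ALL weights, full local–global compatibility
  (verbatim the statement of item stmt-Langlands-1059 `LiftDescend.AutToGalCM` = `CMFern.AutToGalCM`; open
  core: the Hodge–irregular sector — weight-one type in rank `n`, base changes of Maass `λ = 1/4` forms —
  where no cohomological / perfectoid realisation is known; regular weights: HLTT 2016 / Scholze 2015 +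
  Varma, A'Campo, Caraiani–Newton for the local clauses).
* `stub_weakGalToAutCM` — WEAK direction (B) over CM fields GIVEN (A) for the same reciprocity data: every
  irreducible geometric `ρ : Γ_F → GL_n(ℚ̄_ℓ)` (pinned Fontaine datum) is Satake–Frobenius compatible at
  almost all places with some L-algebraic cuspidal `π` (Fontaine–Mazur–Langlands over CM fields in its
  almost-everywhere form; the automorphy-lifting / potential-automorphy / residual-automorphy engines
  CHT, BLGGT, ACC+GHLNSTT live here and consume the `ρ_π` of the hypothesis; open core: Hodge-irregular
  and residually small `ρ`). NEW as a statement (route CMFern cuts it further into fern density +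
  classicality of limits; route LiftDescend into potential automorphy + descent).
* `stub_reciprocityCMtoTR` — reciprocity over all CM fields ⇒ reciprocity over all totally real fields
  (verbatim the route's OWN support item stmt-Langlands-1096 `BaseFieldAscent.ReciprocityCMtoTR`, shared with
  CMFern / SmithKummerSeed: (A) by Sorensen patching over imaginary-quadratic composita, (B) by quadratic
  descent of automorphy; theorem-level but Lean-heavy — transport of `ReciprocityData` along `F_v ≅ (FK)_w`).

The composition `ReciprocityTRCM_of` is kernel-checked and sorry-free and is NOT a one-line seam: for a CM
field it takes `𝓡` from stub 1, gets weak (B) for that `𝓡` from stub 2 and UPGRADES it to the summit's (B)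
(local–global compatibility at every finite place) by the landed Chebotarev–Brauer–Nesbitt transport
`Theorems.ReciprocityUpToIrreducibility.corresponds_of_exists_corresponds` (two irreducible avatars of one
`π` are conjugate; `Corresponds` descends to conjugacy classes) — packaged below as the sorry-free lemma
`galoisToAutomorphic_of_weak`, which is verbatim the body of item stmt-Langlands-1065
`LiftDescend.WeakToStrongGalToAut` (so that support item is now a corollary of the tree); the totally real
case is stub 3 applied to the CM case.

Shape (for `ledger skeleton check` / `#h21_check_skeleton`): each stub is `theorem stub_<name> : <Prop> :=
by sorry` (closed statements over existing declarations only); `_Goal.stub_<name> : Prop := type_of%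
@stub_<name>` names that statement; `ReciprocityTRCM_of (h₁ : _Goal.stub_autToGalCM)
(h₂ : _Goal.stub_weakGalToAutCM) (h₃ : _Goal.stub_reciprocityCMtoTR) : ReciprocityTRCM` concludes the
route decl BY NAME; the last `example` feeds the three stubs to it.

Disproof used: none exists — `ledger crux ls stmt-Langlands-1093` lists no workfiles (no `Disproof.lean`,
no `Negative/` lemma, no dead line) at registration time (2026-08-17); `ledger negatives --problem
Langlands` (3 entries: SplitPrimeInductionDeinduction, OrdinaryPrimeTransportRankinSelbergPoleCount,
K3KugaSatakeDescentSerreTypeAnchor) contains nothing of the shape of these stubs. The one recorded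
misstatement in this corner (LiftDescend `PotentialAutomorphy` rev ≤ 10, `∀ R`-form refuted on paper via a
permissive prover-chosen `R.pst`) cannot recur: `ReciprocityData.pst` is PINNED (D-0018 L2) and ignores
`R`, so `IsGeometricFramed R ρ` in stub 2 is the genuine (Fontaine) notion.
-/

set_option linter.dupNamespace false

noncomputable section

namespace Summit.Langlands.Langlands.Cruxes.ReciprocityTRCM.Birth

open Summit.Langlands.Langlands.Theses.BaseFieldAscent
open Filter

/-! ## 1. The three stubs -/

/-- **STUB 1 — direction (A) over CM fields, all ranks, all weights** (verbatim item stmt-Langlands-1059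
`AutToGalCM` of routes LiftDescend / CMFern): for every CM field `F` there are reciprocity data `𝓡` such
that every L-algebraic cuspidal `π` of `GL_n(𝔸_F)`, `n ≥ 1`, has for all `ℓ`, `ι` an irreducible geometric
`ρ_{π,ι}` corresponding to it at every finite place, unique up to conjugacy. Known in regular weight
(Harris–Lan–Taylor–Thorne, Scholze; local clauses Varma / A'Campo / Caraiani–Newton, monodromy open in
general); OPEN in irregular weight (no realisation in any cohomology; even algebraicity of the Satake
parameters — forced by the `∀ ι` clause — is open). Why it might fail as typed: an L-algebraic `π` with a
transcendental Satake parameter would have no `ρ_{π,ι}` for generic `ι`.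
[cite: HarrisLanTaylorThorneRMS2016, Thm. A] [cite: Scholze2015, Thm. 1.0.4] [cite: BuzzardGeeLMS2014, Conj. 3.2.2] -/
theorem stub_autToGalCM : ∀ (F : Type) [Field F] [NumberField F], NumberField.IsCMField F → ∃ R : ReciprocityData F, ∀ n : ℕ, 0 < n → ∀ hcpt : Literature.NumberTheory.Automorphic.isCompact_glFiniteIntegralLevel n F, AutomorphicToGalois n R hcpt := by
  sorry

/-- **STUB 2 — weak direction (B) over CM fields, given (A) for the same data** (Fontaine–Mazur–Langlands
over CM fields, almost-everywhere form): for a CM field `F` and reciprocity data `𝓡` carrying direction (A)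
in every rank, every irreducible `ρ : Γ_F → GL_n(ℚ̄_ℓ)` which is geometric (unramified almost everywhere,
de Rham above `ℓ` for the PINNED Fontaine datum — `IsGeometricFramed 𝓡 ρ` does not depend on `𝓡`) is
Satake–Frobenius compatible at almost all places with some L-algebraic cuspidal `π` of `GL_n(𝔸_F)`.
The hypothesis (A) is what every automorphy-lifting theorem consumes (the `ρ_{π}` to compare with);
known for regular, residually big / adequate / decomposed-generic `ρ` (CHT, BLGGT Thm. 4.2.1, ACC+
Thm. 6.1.1 over CM fields), OPEN for Hodge-irregular `ρ` (base changes of even Artin representations,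
abelian varieties of dimension ≥ 3) and in residually degenerate cases. Local–global compatibility at the
finite places is NOT asked here: it is recovered in `galoisToAutomorphic_of_weak` from (A).
[cite: FontaineMazurGeometric1995, Conj. 1] [cite: BarnetlambEtAl2014, Thm. 4.2.1] [cite: ACCGHLNSTT2023, Thm. 6.1.1] -/
theorem stub_weakGalToAutCM : ∀ (F : Type) [Field F] [NumberField F], NumberField.IsCMField F → ∀ R : ReciprocityData F, (∀ n : ℕ, 0 < n → ∀ hcpt : Literature.NumberTheory.Automorphic.isCompact_glFiniteIntegralLevel n F, AutomorphicToGalois n R hcpt) → ∀ (n : ℕ), 0 < n → ∀ (ℓ : ℕ) [Fact ℓ.Prime] (ι : PadicAlgCl ℓ ≃+* ℂ) (ρ : Literature.NumberTheory.GaloisRepresentations.FramedGaloisRep F (PadicAlgCl ℓ) n), ρ.toGaloisRep.IsIrreducible → IsGeometricFramed R ρ → ∀ hcpt : Literature.NumberTheory.Automorphic.isCompact_glFiniteIntegralLevel n F, ∃ π : Literature.NumberTheory.Automorphic.CuspidalAutomorphicRepData n F hcpt, π.1.IsLAlgebraic ∧ ∀ᶠ v : IsDedekindDomain.HeightOneSpectrum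 (NumberField.RingOfIntegers F) in cofinite, SatakeFrobCompatibleAt ι π.1 ρ v := by
  sorry

/-- **STUB 3 — reciprocity over all CM fields ⇒ reciprocity over all totally real fields** (verbatim the
route's support item stmt-Langlands-1096 `BaseFieldAscent.ReciprocityCMtoTR`): for `π` over a totally real
`F`, base-change to the imaginary-quadratic composita `FK_i` (Arthur–Clozel; cuspidal for all but finitely
many `K_i`), take `ρ_i` over `FK_i` from the hypothesis, patch (Sorensen's lemma; tree
`Literature.NumberTheory.GaloisRepresentations.PatchingLemma` / `SorensenPatching`), transfer local–global
compatibility and de Rhamness at `v` from a `K_i` split at `v`; direction (B) by quadratic descent of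
automorphy given (A) over `F`. Theorem-level, Lean-heavy (transport of `ReciprocityData` along
`F_v ≅ (FK_i)_w`). [cite: Sorensen2020, Thm. 1] [cite: ArthurClozelAMS120, Ch. 3 Thm. 4.2] -/
theorem stub_reciprocityCMtoTR : (∀ (F : Type) [Field F] [NumberField F], NumberField.IsCMField F → ∃ R : ReciprocityData F, ∀ n : ℕ, 0 < n → ∀ hcpt : Literature.NumberTheory.Automorphic.isCompact_glFiniteIntegralLevel n F, GlobalLanglandsCorrespondenceGLn n F R hcpt) → ∀ (F : Type) [Field F] [NumberField F], NumberField.IsTotallyReal F → ∃ R : ReciprocityData F, ∀ n : ℕ, 0 < n → ∀ hcpt : Literature.NumberTheory.Automorphic.isCompact_glFiniteIntegralLevel n F, GlobalLanglandsCorrespondenceGLn n F R hcpt := by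
  sorry

/-! ## 2. The stub statements as named propositions (the composition's hypotheses, by name)

`_Goal` is internal on purpose: audits listing the file's declarations by short name find the `stub_*`
THEOREMS, while `#h21_check_skeleton` accepts the hypotheses of `ReciprocityTRCM_of` by the stub names they
carry. Each `_Goal.stub_x` is `type_of% @stub_x` — no text duplicated, no `sorry` inherited. -/

namespace _Goal

/-- The statement of `stub_autToGalCM`, as a named `Prop` (literally its type). [folklore] -/
def stub_autToGalCM : Prop :=
  type_of% @Summit.Langlands.Langlands.Cruxes.ReciprocityTRCM.Birth.stub_autToGalCM

/-- The statement of `stub_weakGalToAutCM`, as a named `Prop` (literally its type). [folklore] -/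
def stub_weakGalToAutCM : Prop :=
  type_of% @Summit.Langlands.Langlands.Cruxes.ReciprocityTRCM.Birth.stub_weakGalToAutCM

/-- The statement of `stub_reciprocityCMtoTR`, as a named `Prop` (literally its type). [folklore] -/
def stub_reciprocityCMtoTR : Prop :=
  type_of% @Summit.Langlands.Langlands.Cruxes.ReciprocityTRCM.Birth.stub_reciprocityCMtoTR

end _Goal

/-- Stub 3 IS the route's support item `ReciprocityCMtoTR` (stmt-Langlands-1096), definitionally. [folklore] -/
theorem stub_reciprocityCMtoTR_iff : _Goal.stub_reciprocityCMtoTR ↔ ReciprocityCMtoTR := Iff.rfl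

/-! ## 3. Weak ⇒ strong (B), a theorem of the tree (Chebotarev + Brauer–Nesbitt transport) -/

/-- **Weak-to-strong upgrade of direction (B), for the same reciprocity data** (verbatim the body of item
stmt-Langlands-1065 `LiftDescend.WeakToStrongGalToAut`, here PROVED): if (A) holds for `𝓡` in every rank
and every irreducible geometric `ρ` is Satake–Frobenius compatible a.e. with some L-algebraic cuspidal
`π`, then (B) holds for `𝓡`: (A) gives some `ρ'` corresponding to that `π` at every finite place, `ρ'`
and `ρ` are two avatars of `π` with `ρ` irreducible, hence conjugate (Chebotarev + Brauer–Nesbitt, tree: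
`isConjugate_of_satakeFrobCompatibleAt` with `chebotarev_artinRep_holds`), and `Corresponds` descends to
conjugacy classes (`corresponds_of_exists_corresponds`, landed, sorry-free).
[cite: DeligneSerreASENS1974, Lemme 3.2] [cite: BuzzardGeeLMS2014, Conj. 3.2.2] -/
theorem galoisToAutomorphic_of_weak (F : Type) [Field F] [NumberField F] (R : ReciprocityData F)
    (hA : ∀ n : ℕ, 0 < n →
      ∀ hcpt : Literature.NumberTheory.Automorphic.isCompact_glFiniteIntegralLevel n F,
        AutomorphicToGalois n R hcpt)
    (hW : ∀ (n : ℕ), 0 < n → ∀ (ℓ : ℕ) [Fact ℓ.Prime] (ι : PadicAlgCl ℓ ≃+* ℂ)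
      (ρ : Literature.NumberTheory.GaloisRepresentations.FramedGaloisRep F (PadicAlgCl ℓ) n),
      ρ.toGaloisRep.IsIrreducible → IsGeometricFramed R ρ →
        ∀ hcpt : Literature.NumberTheory.Automorphic.isCompact_glFiniteIntegralLevel n F,
          ∃ π : Literature.NumberTheory.Automorphic.CuspidalAutomorphicRepData n F hcpt,
            π.1.IsLAlgebraic ∧
              ∀ᶠ v : IsDedekindDomain.HeightOneSpectrum (NumberField.RingOfIntegers F) in cofinite,
                SatakeFrobCompatibleAt ι π.1 ρ v) :
    ∀ n : ℕ, 0 < n →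
      ∀ hcpt : Literature.NumberTheory.Automorphic.isCompact_glFiniteIntegralLevel n F,
        GaloisToAutomorphic n R hcpt := by
  intro n hn hcpt ℓ _ ι ρ hirr hgeo
  obtain ⟨π, hL, hsat⟩ := hW n hn ℓ ι ρ hirr hgeo hcpt
  obtain ⟨ρ', -, -, hcorr', -⟩ := hA n hn hcpt π hL ℓ ι
  exact ⟨π, hL,
    Theorems.ReciprocityUpToIrreducibility.corresponds_of_exists_corresponds hirr hsat ⟨ρ', hcorr'⟩⟩

/-! ## 4. The composition (kernel-checked, no `sorry`): (A)_CM → weak (B)_CM → (CM ⇒ TR) → crux by name -/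

/-- **`ReciprocityTRCM` from the three stubs.** CM fields: `𝓡` and (A) from stub 1; weak (B) for that
`𝓡` from stub 2; (B) with local–global compatibility everywhere by `galoisToAutomorphic_of_weak`; so
`GlobalLanglandsCorrespondenceGLn n F 𝓡 hcpt = (A) ∧ (B)` for every `n ≥ 1`. Totally real fields: stub 3
applied to the CM statement just proved. The hypotheses are, by name, the statements of
`stub_autToGalCM`, `stub_weakGalToAutCM`, `stub_reciprocityCMtoTR`; the conclusion is the route decl.
[folklore] -/
theorem ReciprocityTRCM_of (h₁ : _Goal.stub_autToGalCM) (h₂ : _Goal.stub_weakGalToAutCM)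
    (h₃ : _Goal.stub_reciprocityCMtoTR) : ReciprocityTRCM := by
  -- the stub statements, unfolded to their `∀`-form
  have hA : ∀ (F : Type) [Field F] [NumberField F], NumberField.IsCMField F →
      ∃ R : ReciprocityData F, ∀ n : ℕ, 0 < n →
        ∀ hcpt : Literature.NumberTheory.Automorphic.isCompact_glFiniteIntegralLevel n F,
          AutomorphicToGalois n R hcpt := h₁
  have hTR : _Goal.stub_reciprocityCMtoTR := h₃
  unfold _Goal.stub_reciprocityCMtoTR at hTR
  unfold _Goal.stub_weakGalToAutCM at h₂
  -- reciprocity over every CM field, for the data of stub 1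
  have hCM : ∀ (F : Type) [Field F] [NumberField F], NumberField.IsCMField F →
      ∃ R : ReciprocityData F, ∀ n : ℕ, 0 < n →
        ∀ hcpt : Literature.NumberTheory.Automorphic.isCompact_glFiniteIntegralLevel n F,
          GlobalLanglandsCorrespondenceGLn n F R hcpt := by
    intro F _ _ hF
    obtain ⟨R, hAR⟩ := hA F hF
    exact ⟨R, fun n hn hcpt =>
      ⟨hAR n hn hcpt, galoisToAutomorphic_of_weak F R hAR (h₂ F hF R hAR) n hn hcpt⟩⟩
  -- totally real ∪ CM
  intro F _ _ hF
  rcases hF with hTRF | hCMF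
  · exact hTR hCM F hTRF
  · exact hCM F hCMF

/-- By-name sanity check (an `example`, not a declaration of the file): the three stubs feed the
composition as they stand. -/
example : ReciprocityTRCM := ReciprocityTRCM_of stub_autToGalCM stub_weakGalToAutCM stub_reciprocityCMtoTR

end Summit.Langlands.Langlands.Cruxes.ReciprocityTRCM.Birth

end
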